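import Mathlib
import Literature.NumberTheory.Sieve.BombieriVinogradovMoebius
import Literature.NumberTheory.Sieve.MoebiusResidueClassSums
import Literature.NumberTheory.Sieve.LinearFormPairCongruences
import HarnessLib

/-!
# Crux `PolyMobiusTail` (stmt-Parity-0870), line `eta-free-multilinear-window`:
# helper for `stub_pair_corner` — the residue classes met after the divisor switch

Aux stub `stub_pair_corner_classes` (head theorem) and `PairCorner.sum_abs_switched_le`.

For the CORNER `min(d₀, d₁) ≤ x^σ` of the linear pair window (`f₀ = q₀ X + a₀`, `f₁ = q₁ X + a₁`) one
reparametrises by `(d, m)` with `d ∣ f₀(n)` the small divisor and `m = f₁(n)/b` the cofactor of the other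
divisor `b`; for fixed `(d, m)` the admissible `b` form an interval intersected with at most `|Δ|`
(`Δ = q₁ a₀ - q₀ a₁`) residue classes modulo `q₁ d`
(`Literature.NumberTheory.Sieve.LinearFormPair.*`), and the `b`-sum `∑ μ(b) log b` over them is
bounded by ONE term of the Bombieri–Vinogradov sum for `μ`
(`Literature.NumberTheory.Sieve.BVMoebius.exists_sum_abs_sum_moebius_log_congr_le`: partial
summation and the passage from a non-reduced class to a reduced one).  `sum_abs_switched_le` then sums
the squarefree `d ≤ D` with the Bombieri–Vinogradov theorem for `μ` over the dilated moduli `q₁ d`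
(`BVMoebius.sum_abs_moebiusAPSum_dilate_le`, taken as a hypothesis at the height `Y = f₁(x)/m`).
-/


open scoped BigOperators
open Filter Finset Asymptotics

namespace Summit.Parity.BatemanHorn.Theorems.PolyMobiusTail.EtaFreeWindow

open Literature.NumberTheory.Sieve

/-- **Aux stub `stub_pair_corner_classes` (helper for `stub_pair_corner`, line eta-free-multilinear-window).**
For a pair of linear forms `P(n) = q₀ n + a₀`, `R(n) = q₁ n + a₁` (`q₁ ≥ 1`, `gcd(q₁, a₁) = 1`,
`Δ = q₁ a₀ - q₀ a₁ ≠ 0`, both forms positive from `n₁` on), a squarefree `d` and a cofactor `m ≥ 1`,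
the divisor-switched `b`-sum of the corner — `∑ μ(b) log b` over the `b` in the window
`x^{1-η} < d b ≤ x^{1+θ}`, `d ≤ x^σ` for which some `n ∈ [n₁, x]` has `d ∣ P(n)` and `b m = R(n)` —
is at most `2 Δ² log R(x)` times ONE term `|∑_{b ≤ t, b ≡ a (q₁ d)} μ(b)|` of the Bombieri–Vinogradov
sum for `μ` (reduced `a`, cut-off `t ≤ R(x)/m`): the admissible `b` are an interval intersected with
at most `|Δ|` classes modulo `q₁ d`, each with gcd a unitary divisor of `q₁ d` dividing `Δ`
(`Literature.NumberTheory.Sieve.LinearFormPair.*`), and each class costs `2 log N` by partial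
summation and a factor `≤ |Δ|` for the passage to a reduced class
(`Literature.NumberTheory.Sieve.BVMoebius.exists_sum_abs_sum_moebius_log_congr_le`). [folklore] -/
theorem stub_pair_corner_classes : ∀ (q₀ q₁ : ℕ) (a₀ a₁ : ℤ), 0 < q₁ → Int.gcd (q₁ : ℤ) a₁ = 1 →
    (q₁ : ℤ) * a₀ - (q₀ : ℤ) * a₁ ≠ 0 → ∀ (n₁ : ℕ), 0 < (q₀ : ℤ) * n₁ + a₀ → 0 < (q₁ : ℤ) * n₁ + a₁ →
    ∀ (σ η θ : ℝ) (x d m : ℕ), n₁ ≤ x → Squarefree d → 0 < m →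
    ∃ t : ℕ, t ≤ ((q₁ : ℤ) * x + a₁).toNat / m ∧ ∃ a : ℕ, a.Coprime (q₁ * d) ∧
      |∑ b ∈ (Finset.Icc 1 ((q₁ : ℤ) * x + a₁).toNat).filter (fun b : ℕ =>
          ((x : ℝ) ^ (1 - η) < (d : ℝ) * (b : ℝ) ∧ (d : ℝ) * (b : ℝ) ≤ (x : ℝ) ^ (1 + θ) ∧
            (d : ℝ) ≤ (x : ℝ) ^ σ) ∧
          ∃ n ∈ Finset.Icc n₁ x, d ∣ ((q₀ : ℤ) * n + a₀).toNat ∧ b * m = ((q₁ : ℤ) * n + a₁).toNat),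
        (ArithmeticFunction.moebius b : ℝ) * Real.log b| ≤
      2 * ((((q₁ : ℤ) * a₀ - (q₀ : ℤ) * a₁).natAbs : ℕ) : ℝ) ^ 2 * Real.log ((q₁ : ℝ) * x + a₁) *
        |Literature.NumberTheory.Sieve.BVMoebius.moebiusAPSum t (q₁ * d) (a : ZMod (q₁ * d))| := by
  intro q₀ q₁ a₀ a₁ hq₁ hcop hΔ n₁ hP hR σ η θ x d m hx hd hm
  set Δ : ℤ := (q₁ : ℤ) * a₀ - (q₀ : ℤ) * a₁ with hΔdef
  set s : ℕ := Δ.natAbs with hsdef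
  have hs0 : 0 < s := Int.natAbs_pos.2 hΔ
  have hd0 : 0 < d := Nat.pos_of_ne_zero hd.ne_zero
  set L : ℕ := q₁ * d with hLdef
  have hL : 0 < L := Nat.mul_pos hq₁ hd0
  set Bx : ℕ := ((q₁ : ℤ) * x + a₁).toNat with hBxdef
  have hRx : 0 < (q₁ : ℤ) * x + a₁ := by
    have : (q₁ : ℤ) * n₁ ≤ (q₁ : ℤ) * x :=
      mul_le_mul_of_nonneg_left (by exact_mod_cast hx) (by positivity)
    linarith
  have hBxz : (Bx : ℤ) = (q₁ : ℤ) * x + a₁ := Int.toNat_of_nonneg hRx.le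
  -- the window and the congruence conditions
  set W : ℕ → Prop := fun b => (x : ℝ) ^ (1 - η) < (d : ℝ) * (b : ℝ) ∧
    (d : ℝ) * (b : ℝ) ≤ (x : ℝ) ^ (1 + θ) ∧ (d : ℝ) ≤ (x : ℝ) ^ σ with hWdef
  set cond : ℕ → Prop := fun b => (q₁ : ℤ) ∣ (b : ℤ) * m - a₁ ∧
    (q₁ : ℤ) * d ∣ (q₀ : ℤ) * m * b + Δ with hconddef
  set Conv : Finset ℕ := (Icc 1 Bx).filter (fun b => W b ∧
    ((q₁ : ℤ) * n₁ + a₁ ≤ (b : ℤ) * m ∧ (b : ℤ) * m ≤ (q₁ : ℤ) * x + a₁)) with hConvdef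
  -- Step 1: the set of `b` is `Conv ∩ cond`
  have hset : (Icc 1 Bx).filter (fun b : ℕ => W b ∧
      ∃ n ∈ Icc n₁ x, d ∣ ((q₀ : ℤ) * n + a₀).toNat ∧ b * m = ((q₁ : ℤ) * n + a₁).toNat) =
      Conv.filter cond := by
    ext b
    simp only [hConvdef, mem_filter, Finset.filter_filter]
    have key := LinearFormPair.exists_dvd_and_mul_eq_iff (q₀ := q₀) hq₁ hP hR d m b x
    have hex : (∃ n ∈ Icc n₁ x, d ∣ ((q₀ : ℤ) * n + a₀).toNat ∧ b * m = ((q₁ : ℤ) * n + a₁).toNat) ↔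
        (∃ n : ℕ, n₁ ≤ n ∧ n ≤ x ∧ d ∣ ((q₀ : ℤ) * n + a₀).toNat ∧
          b * m = ((q₁ : ℤ) * n + a₁).toNat) := by
      constructor
      · rintro ⟨n, hn, h1, h2⟩; exact ⟨n, (mem_Icc.1 hn).1, (mem_Icc.1 hn).2, h1, h2⟩
      · rintro ⟨n, hn1, hn2, h1, h2⟩; exact ⟨n, mem_Icc.2 ⟨hn1, hn2⟩, h1, h2⟩
    rw [hex, key]
    simp only [hconddef]
    tauto
  -- Step 2: `Conv` is an interval `(N', N]` with `N ≤ Bx / m`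
  have hConv0 : (0 : ℕ) ∉ Conv := by
    rw [hConvdef, mem_filter, mem_Icc]; omega
  have hConvex : ∀ a ∈ Conv, ∀ c ∈ Conv, ∀ b, a ≤ b → b ≤ c → b ∈ Conv := by
    intro a ha c hc b hab hbc
    rw [hConvdef, mem_filter, mem_Icc] at ha hc ⊢
    have hab' : (a : ℝ) ≤ b := by exact_mod_cast hab
    have hbc' : (b : ℝ) ≤ c := by exact_mod_cast hbc
    have habz : (a : ℤ) ≤ b := by exact_mod_cast hab
    have hbcz : (b : ℤ) ≤ c := by exact_mod_cast hbc
    have hd0' : (0 : ℝ) ≤ d := Nat.cast_nonneg d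
    have hm0 : (0 : ℤ) ≤ m := Int.natCast_nonneg m
    refine ⟨⟨by omega, by omega⟩, ⟨?_, ?_, ha.2.1.2.2⟩, ?_, ?_⟩
    · exact lt_of_lt_of_le ha.2.1.1 (mul_le_mul_of_nonneg_left hab' hd0')
    · exact le_trans (mul_le_mul_of_nonneg_left hbc' hd0') hc.2.1.2.1
    · exact le_trans ha.2.2.1 (mul_le_mul_of_nonneg_right habz hm0)
    · exact le_trans (mul_le_mul_of_nonneg_right hbcz hm0) hc.2.2.2
  obtain ⟨N', N, hConvI, hNle⟩ := LinearFormPair.exists_eq_Ioc_of_ordConnected Conv hConv0 hConvex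
  have hNU : N ≤ Bx / m := by
    refine hNle _ fun b hb => ?_
    rw [hConvdef, mem_filter] at hb
    rw [Nat.le_div_iff_mul_le hm]
    have : (b : ℤ) * m ≤ Bx := by rw [hBxz]; exact hb.2.2.2
    exact_mod_cast this
  -- Step 3: split into classes modulo `L`
  have hper : ∀ b, cond b ↔ cond (b % L) := fun b =>
    LinearFormPair.congr_cond_iff_mod q₀ q₁ d m a₁ Δ b
  have hsplit := LinearFormPair.sum_filter_periodic_eq hL cond hper (Ioc N' N)
    (fun b => (ArithmeticFunction.moebius b : ℝ) * Real.log b)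
  -- Step 4: the per-modulus bound
  set 𝒞 := (range L).filter cond with h𝒞def
  have hcard : #𝒞 ≤ s := LinearFormPair.card_filter_congr_cond_le (q₀ := q₀) hq₁ hd0 m a₁ hΔ
  have hcls : ∀ c ∈ 𝒞, Nat.gcd c L ≤ s ∧ (Nat.gcd c L).Coprime (L / Nat.gcd c L) := by
    intro c hc
    rw [h𝒞def, mem_filter] at hc
    obtain ⟨h1, h2⟩ := LinearFormPair.gcd_dvd_and_coprime_of_congr_cond (q₀ := q₀) hd hcop
      hc.2.1 hc.2.2
    exact ⟨Nat.le_of_dvd hs0 h1, h2⟩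
  obtain ⟨t, htN, a, ha, hbound⟩ := BVMoebius.exists_sum_abs_sum_moebius_log_congr_le hL 𝒞 hcard
    (fun c hc => (hcls c hc).1) (fun c hc => (hcls c hc).2) N' N
  refine ⟨t, htN.trans hNU, a, ha, ?_⟩
  rw [hset, hConvI, hsplit]
  refine (abs_sum_le_sum_abs _ _).trans (hbound.trans ?_)
  -- Step 5: `log N ≤ log R(x)`
  have hlogN : Real.log N ≤ Real.log ((q₁ : ℝ) * x + a₁) := by
    have hRx1 : (1 : ℝ) ≤ (q₁ : ℝ) * x + a₁ := by
      have : (1 : ℤ) ≤ (q₁ : ℤ) * x + a₁ := hRx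
      exact_mod_cast this
    rcases Nat.eq_zero_or_pos N with hN0 | hNpos
    · rw [hN0, Nat.cast_zero, Real.log_zero]; exact Real.log_nonneg hRx1
    · refine Real.log_le_log (by exact_mod_cast hNpos) ?_
      have h1 : (N : ℝ) ≤ Bx := by exact_mod_cast hNU.trans (Nat.div_le_self _ _)
      have h2 : ((Bx : ℤ) : ℝ) = (q₁ : ℝ) * x + a₁ := by rw [hBxz]; push_cast; ring
      have h3 : (Bx : ℝ) = (q₁ : ℝ) * x + a₁ := by exact_mod_cast h2
      linarith
  have h0 : (0 : ℝ) ≤ 2 * (s : ℝ) ^ 2 := by positivity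
  calc 2 * (s : ℝ) ^ 2 * Real.log N * |BVMoebius.moebiusAPSum t L (a : ZMod L)|
      ≤ 2 * (s : ℝ) ^ 2 * Real.log ((q₁ : ℝ) * x + a₁) * |BVMoebius.moebiusAPSum t L (a : ZMod L)| :=
        mul_le_mul_of_nonneg_right (mul_le_mul_of_nonneg_left hlogN h0) (abs_nonneg _)
    _ = _ := by rfl

namespace PairCorner

/-- The `d`-sum of the switched corner for one cofactor `m`, bounded by Bombieri–Vinogradov for `μ`
at `Y = R(x)/m`: given the level condition `q₁ d ≤ Y^{1/2} (log Y)^{-B}` for `d ≤ D` and `Y ≥ x₀`,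
`∑_{d ≤ D} |μ(d) log d · V_b(x, d, m)| ≤ log x · 2Δ² log R(x) · C Y (log Y)^{-4}`. [folklore] -/
theorem sum_abs_switched_le {q₀ q₁ : ℕ} {a₀ a₁ : ℤ} (hq₁ : 0 < q₁) (hcop : Int.gcd (q₁ : ℤ) a₁ = 1)
    (hΔ : (q₁ : ℤ) * a₀ - (q₀ : ℤ) * a₁ ≠ 0) {n₁ : ℕ} (hP : 0 < (q₀ : ℤ) * n₁ + a₀)
    (hR : 0 < (q₁ : ℤ) * n₁ + a₁) (σ η θ : ℝ) {x : ℕ} (hx : n₁ ≤ x) {m : ℕ} (hm : 0 < m)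
    {D : ℕ} (hDx : ∀ d ∈ Finset.Icc 1 D, Real.log d ≤ Real.log x) {B C x₀ Y : ℝ}
    (hBV : ∀ y : ℝ, x₀ ≤ y → ∀ k : ℕ, 0 < k →
      ∀ 𝒟 : Finset ℕ, (∀ d ∈ 𝒟, 1 ≤ d ∧ ((k * d : ℕ) : ℝ) ≤ y ^ (1 / 2 : ℝ) / Real.log y ^ B) →
      ∀ t : ℕ → ℕ, (∀ d, (t d : ℝ) ≤ y) →
      ∀ a : ℕ → ℕ, (∀ d ∈ 𝒟, (a d).Coprime (k * d)) →
        ∑ d ∈ 𝒟, |BVMoebius.moebiusAPSum (t d) (k * d) ((a d : ℕ) : ZMod (k * d))| ≤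
          C * y / Real.log y ^ (4 : ℝ))
    (hY₀ : x₀ ≤ Y) (hYt : (((((q₁ : ℤ) * x + a₁).toNat / m : ℕ) : ℝ)) ≤ Y)
    (hlev : ∀ d ∈ Finset.Icc 1 D, ((q₁ * d : ℕ) : ℝ) ≤ Y ^ (1 / 2 : ℝ) / Real.log Y ^ B) :
    ∑ d ∈ Finset.Icc 1 D, |(ArithmeticFunction.moebius d : ℝ) * Real.log d *
        ∑ b ∈ (Finset.Icc 1 ((q₁ : ℤ) * x + a₁).toNat).filter (fun b : ℕ => ((x : ℝ) ^ (1 - η) < (d : ℝ) * (b : ℝ) ∧ (d : ℝ) * (b : ℝ) ≤ (x : ℝ) ^ (1 + θ) ∧ (d : ℝ) ≤ (x : ℝ) ^ σ) ∧ ∃ n ∈ Finset.Icc n₁ x, d ∣ ((q₀ : ℤ) * n + a₀).toNat ∧ b * m = ((q₁ : ℤ) * n + a₁).toNat), (ArithmeticFunction.moebius b : ℝ) * Real.log b| ≤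
      Real.log x * (2 * ((((q₁ : ℤ) * a₀ - (q₀ : ℤ) * a₁).natAbs : ℕ) : ℝ) ^ 2 *
        Real.log ((q₁ : ℝ) * x + a₁)) * (C * Y / Real.log Y ^ (4 : ℝ)) := by
  classical
  set s : ℕ := ((q₁ : ℤ) * a₀ - (q₀ : ℤ) * a₁).natAbs with hsdef
  have hRx : 0 < (q₁ : ℤ) * x + a₁ := by
    have : (q₁ : ℤ) * n₁ ≤ (q₁ : ℤ) * x :=
      mul_le_mul_of_nonneg_left (by exact_mod_cast hx) (by positivity)
    linarith
  have hlogR : 0 ≤ Real.log ((q₁ : ℝ) * x + a₁) := by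
    refine Real.log_nonneg ?_
    have : (1 : ℤ) ≤ (q₁ : ℤ) * x + a₁ := hRx
    exact_mod_cast this
  -- the Bombieri–Vinogradov terms, one per squarefree `d`
  have hS1 : ∀ d : ℕ, Squarefree d → ∃ t : ℕ, t ≤ ((q₁ : ℤ) * x + a₁).toNat / m ∧ ∃ a : ℕ, a.Coprime (q₁ * d) ∧
      |∑ b ∈ (Finset.Icc 1 ((q₁ : ℤ) * x + a₁).toNat).filter (fun b : ℕ => ((x : ℝ) ^ (1 - η) < (d : ℝ) * (b : ℝ) ∧ (d : ℝ) * (b : ℝ) ≤ (x : ℝ) ^ (1 + θ) ∧ (d : ℝ) ≤ (x : ℝ) ^ σ) ∧ ∃ n ∈ Finset.Icc n₁ x, d ∣ ((q₀ : ℤ) * n + a₀).toNat ∧ b * m = ((q₁ : ℤ) * n + a₁).toNat), (ArithmeticFunction.moebius b : ℝ) * Real.log b| ≤ 2 * (s : ℝ) ^ 2 * Real.log ((q₁ : ℝ) * x + a₁) *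
        |BVMoebius.moebiusAPSum t (q₁ * d) (a : ZMod (q₁ * d))| :=
    fun d hd => stub_pair_corner_classes q₀ q₁ a₀ a₁ hq₁ hcop hΔ n₁ hP hR σ η θ x d m hx hd hm
  choose! t ht a ha hb using hS1
  set 𝒟 := (Finset.Icc 1 D).filter Squarefree with h𝒟def
  set t' : ℕ → ℕ := fun d => if Squarefree d then t d else 0 with ht'def
  have ht' : ∀ d, (t' d : ℝ) ≤ Y := by
    intro d
    simp only [ht'def]
    split_ifs with hd
    · exact le_trans (by exact_mod_cast ht d hd) hYt
    · simp only [Nat.cast_zero]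
      exact le_trans (Nat.cast_nonneg _) hYt
  have hBVY := hBV Y hY₀ q₁ hq₁ 𝒟 (fun d hd => ?_) t' ht' a (fun d hd => ?_)
  rotate_left
  · rw [h𝒟def, Finset.mem_filter] at hd
    exact ⟨(Finset.mem_Icc.1 hd.1).1, hlev d hd.1⟩
  · rw [h𝒟def, Finset.mem_filter] at hd
    exact ha d hd.2
  -- drop the non-squarefree `d`, then compare termwise
  have hdrop : ∑ d ∈ Finset.Icc 1 D, |(ArithmeticFunction.moebius d : ℝ) * Real.log d *
        ∑ b ∈ (Finset.Icc 1 ((q₁ : ℤ) * x + a₁).toNat).filter (fun b : ℕ => ((x : ℝ) ^ (1 - η) < (d : ℝ) * (b : ℝ) ∧ (d : ℝ) * (b : ℝ) ≤ (x : ℝ) ^ (1 + θ) ∧ (d : ℝ) ≤ (x : ℝ) ^ σ) ∧ ∃ n ∈ Finset.Icc n₁ x, d ∣ ((q₀ : ℤ) * n + a₀).toNat ∧ b * m = ((q₁ : ℤ) * n + a₁).toNat), (ArithmeticFunction.moebius b : ℝ) * Real.log b| =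
      ∑ d ∈ 𝒟, |(ArithmeticFunction.moebius d : ℝ) * Real.log d *
        ∑ b ∈ (Finset.Icc 1 ((q₁ : ℤ) * x + a₁).toNat).filter (fun b : ℕ => ((x : ℝ) ^ (1 - η) < (d : ℝ) * (b : ℝ) ∧ (d : ℝ) * (b : ℝ) ≤ (x : ℝ) ^ (1 + θ) ∧ (d : ℝ) ≤ (x : ℝ) ^ σ) ∧ ∃ n ∈ Finset.Icc n₁ x, d ∣ ((q₀ : ℤ) * n + a₀).toNat ∧ b * m = ((q₁ : ℤ) * n + a₁).toNat), (ArithmeticFunction.moebius b : ℝ) * Real.log b| := by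
    rw [h𝒟def, Finset.sum_filter_of_ne]
    intro d _ hne
    by_contra hnsq
    apply hne
    rw [ArithmeticFunction.moebius_eq_zero_of_not_squarefree hnsq]
    simp
  rw [hdrop]
  calc ∑ d ∈ 𝒟, |(ArithmeticFunction.moebius d : ℝ) * Real.log d *
        ∑ b ∈ (Finset.Icc 1 ((q₁ : ℤ) * x + a₁).toNat).filter (fun b : ℕ => ((x : ℝ) ^ (1 - η) < (d : ℝ) * (b : ℝ) ∧ (d : ℝ) * (b : ℝ) ≤ (x : ℝ) ^ (1 + θ) ∧ (d : ℝ) ≤ (x : ℝ) ^ σ) ∧ ∃ n ∈ Finset.Icc n₁ x, d ∣ ((q₀ : ℤ) * n + a₀).toNat ∧ b * m = ((q₁ : ℤ) * n + a₁).toNat), (ArithmeticFunction.moebius b : ℝ) * Real.log b|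
      ≤ ∑ d ∈ 𝒟, Real.log x * (2 * (s : ℝ) ^ 2 * Real.log ((q₁ : ℝ) * x + a₁) *
          |BVMoebius.moebiusAPSum (t' d) (q₁ * d) (a d : ZMod (q₁ * d))|) := by
        refine Finset.sum_le_sum fun d hd => ?_
        rw [h𝒟def, Finset.mem_filter] at hd
        have hd1 : (1 : ℝ) ≤ d := by exact_mod_cast (Finset.mem_Icc.1 hd.1).1
        rw [abs_mul, abs_mul]
        have h1 : |(ArithmeticFunction.moebius d : ℝ)| ≤ 1 := by
          exact_mod_cast ArithmeticFunction.abs_moebius_le_one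
        have h2 : |Real.log (d : ℝ)| ≤ Real.log x := by
          rw [abs_of_nonneg (Real.log_nonneg hd1)]; exact hDx d hd.1
        have h3 := hb d hd.2
        have ht'd : t' d = t d := by simp only [ht'def, if_pos hd.2]
        rw [ht'd]
        calc |(ArithmeticFunction.moebius d : ℝ)| * |Real.log (d : ℝ)| *
              |∑ b ∈ (Finset.Icc 1 ((q₁ : ℤ) * x + a₁).toNat).filter (fun b : ℕ => ((x : ℝ) ^ (1 - η) < (d : ℝ) * (b : ℝ) ∧ (d : ℝ) * (b : ℝ) ≤ (x : ℝ) ^ (1 + θ) ∧ (d : ℝ) ≤ (x : ℝ) ^ σ) ∧ ∃ n ∈ Finset.Icc n₁ x, d ∣ ((q₀ : ℤ) * n + a₀).toNat ∧ b * m = ((q₁ : ℤ) * n + a₁).toNat), (ArithmeticFunction.moebius b : ℝ) * Real.log b|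
            ≤ 1 * Real.log x * (2 * (s : ℝ) ^ 2 * Real.log ((q₁ : ℝ) * x + a₁) *
                |BVMoebius.moebiusAPSum (t d) (q₁ * d) (a d : ZMod (q₁ * d))|) := by
              refine mul_le_mul (mul_le_mul h1 h2 (abs_nonneg _) zero_le_one) h3 (abs_nonneg _) ?_
              positivity
          _ = _ := by ring
    _ = Real.log x * (2 * (s : ℝ) ^ 2 * Real.log ((q₁ : ℝ) * x + a₁)) *
          ∑ d ∈ 𝒟, |BVMoebius.moebiusAPSum (t' d) (q₁ * d) (a d : ZMod (q₁ * d))| := by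
        rw [Finset.mul_sum]
        refine Finset.sum_congr rfl fun d _ => by ring
    _ ≤ Real.log x * (2 * (s : ℝ) ^ 2 * Real.log ((q₁ : ℝ) * x + a₁)) *
          (C * Y / Real.log Y ^ (4 : ℝ)) := by
        refine mul_le_mul_of_nonneg_left hBVY ?_
        positivity

end PairCorner

end Summit.Parity.BatemanHorn.Theorems.PolyMobiusTail.EtaFreeWindow
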